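import Mathlib
import HarnessLib
import Summits.Ventures.LatticeQCDFlow.Exactness.IMHMultiProposalMinorisation
import Summits.Ventures.LatticeQCDFlow.Scaling.AutoregressiveGaugeHeatBathColdExact

/-!
# LatticeQCDFlow / Scaling — the ENSEMBLE version of the exact one-plaquette heat-bath sampler (`A = Z/(c^{#B}M^k)`): proposing `m + 1` gauge configurations
# per update and resampling one of the `m + 2` with probability `∝` its importance weight is EXACT for the Wilson law and converges from every start at
# rate at least `(m + 1)/(2/A + m)` per update

HONEST FRAMING: exact (Metropolis-corrected) sampling algorithms for lattice gauge theory;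
figures of merit are autocorrelation/cost numbers at stated couplings and volumes; no
continuum-physics claim.

Venture `LatticeQCDFlow` (cell pub-lqcd), topic `Scaling`, FANOUT row 30 (lean-1, GEN-41) — OUR WORK, the gauge instance of this generation's
abstract `Exactness/IMHMultiProposalExact` and `Exactness/IMHMultiProposalMinorisation` for the exact one-plaquette heat-bath sampler of
`Scaling/AutoregressiveGaugeHeatBathColdExact` (plaquette weight `w` continuous, pinched `0 < m₀ ≤ w ≤ M₀` with `w(1) = M₀`; heat-bath plaquettes `B`
redrawn along admissible links `t` in an acyclic order `rank`; target `π` = the Wilson-type law `∏_p w(U_p)·Haar^{⊗E}/Z`; proposal `q` = the heat-bath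
law; importance weight `dπ/dq`, maximal at the cold configuration where it equals `1/A`, `A = Z/(c^{#B} M₀^{#Bᶜ})`, `c = ∫ w dHaar`, the displayed
cold acceptance).  DEF-FREE: the ensemble kernel is any Markov kernel `P` satisfying the pool-selection equation for `q` and this weight with `m + 1`
fresh proposals.  Twin of `Scaling/AutoregressiveGaugeAllClosingMultiProposal`.

* **`heatBath_multiProposal_invariant`** — `∫ P(U, S) π(dU) = π(S)`: THE ENSEMBLE HEAT-BATH SAMPLER IS EXACT FOR THE WILSON-TYPE LAW.
* **`heatBath_multiProposal_uniformlyErgodic`** — `|μ₀Pᵗ(S) − π(S)| ≤ (1 − (m + 1)/(2/A + m))ᵗ` for every initial law, every `t`, every set `S`, with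
  `1/A = c^{#B} M₀^{#Bᶜ}/Z`: batching `m + 1 ≈ 2/A` proposals per update halves the distance to the Wilson-type law at every update.
NOT CLAIMED: cost comparisons with `m + 1` single-proposal updates; any value of `A`.  No `def`, no `sorry`, nothing cited as a fact.
-/

noncomputable section

namespace Summit.Ventures.LatticeQCDFlow.Theory2.Autoregressive

open MeasureTheory ProbabilityTheory Function Finset
open scoped ENNReal
open Literature.MathematicalPhysics.QuantumFieldTheory Literature.MathematicalPhysics.QuantumLattice
open Summit.Ventures.LatticeQCDFlow.Exactness Summit.Ventures.LatticeQCDFlow.Scoring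

variable {d L : ℕ} [NeZero L] {G : Type*} [Group G] [TopologicalSpace G] [IsTopologicalGroup G]
  [CompactSpace G] [SecondCountableTopology G] [MeasurableSpace G] [BorelSpace G]

/-- **THE ENSEMBLE HEAT-BATH SAMPLER IS EXACT** (pool selection with `m + 1` fresh proposals of the exact one-plaquette heat-bath sampler):
`∫ P(U, S) π(dU) = π(S)` for every measurable `S`. [ours] -/
theorem heatBath_multiProposal_invariant (hL : 2 ≤ L) {w : G → ℝ} (hw : Continuous w) {m₀ M₀ : ℝ} (hm0 : 0 < m₀)
    (hm : ∀ g, m₀ ≤ w g) (hM : ∀ g, w g ≤ M₀) (hw1 : w 1 = M₀)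
    (B : Finset (Plaquette d L)) (t : Plaquette d L → Edge d L)
    (ht : ∀ p ∈ B, t p ∈ ({(p.1, p.2.1.1), (p.1.shift p.2.1.1, p.2.1.2),
        (p.1.shift p.2.1.2, p.2.1.1), (p.1, p.2.1.2)} : Finset (Edge d L)))
    (rank : Plaquette d L → ℕ)
    (hrank : ∀ p ∈ B, ∀ p' ∈ B, p ≠ p' → t p ∈ ({(p'.1, p'.2.1.1), (p'.1.shift p'.2.1.1, p'.2.1.2),
        (p'.1.shift p'.2.1.2, p'.2.1.1), (p'.1, p'.2.1.2)} : Finset (Edge d L)) → rank p < rank p')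
    (π q : Measure (GaugeConfig d L G)) [IsProbabilityMeasure π] [IsProbabilityMeasure q]
    (hπ : π = (Measure.pi fun _ : Edge d L => haarProbability G).withDensity fun U =>
      ENNReal.ofReal ((∏ p : Plaquette d L, w (plaquetteHolonomy U p.1 p.2.1.1 p.2.1.2)) /
        ∫ V, ∏ p : Plaquette d L, w (plaquetteHolonomy V p.1 p.2.1.1 p.2.1.2)
          ∂(Measure.pi fun _ : Edge d L => haarProbability G)))
    (hq : q = (Measure.pi fun _ : Edge d L => haarProbability G).withDensity fun U =>
      ENNReal.ofReal ((∏ p ∈ B, w (plaquetteHolonomy U p.1 p.2.1.1 p.2.1.2)) /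
        ∫ V, ∏ p ∈ B, w (plaquetteHolonomy V p.1 p.2.1.1 p.2.1.2)
          ∂(Measure.pi fun _ : Edge d L => haarProbability G)))
    {m : ℕ} (P : Kernel (GaugeConfig d L G) (GaugeConfig d L G))
    (hP : ∀ (U : GaugeConfig d L G) {S : Set (GaugeConfig d L G)}, MeasurableSet S → P U S =
      ∫⁻ y, (∑ j, ENNReal.ofReal ((fun U : GaugeConfig d L G =>
        (((∫ V, ∏ p : Plaquette d L, w (plaquetteHolonomy V p.1 p.2.1.1 p.2.1.2) ∂(Measure.pi fun _ : Edge d L => haarProbability G)) /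
          ((∫ V, ∏ p ∈ B, w (plaquetteHolonomy V p.1 p.2.1.1 p.2.1.2)
            ∂(Measure.pi fun _ : Edge d L => haarProbability G)) *
            ∏ p ∈ Finset.univ \ B, w (plaquetteHolonomy U p.1 p.2.1.1 p.2.1.2))))⁻¹) (Fin.cons (α := fun _ : Fin (m + 2) => GaugeConfig d L G) U y j)) *
        S.indicator (fun _ => (1 : ℝ≥0∞)) (Fin.cons (α := fun _ : Fin (m + 2) => GaugeConfig d L G) U y j)) /
      (∑ i, ENNReal.ofReal ((fun U : GaugeConfig d L G =>
        (((∫ V, ∏ p : Plaquette d L, w (plaquetteHolonomy V p.1 p.2.1.1 p.2.1.2) ∂(Measure.pi fun _ : Edge d L => haarProbability G)) /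
          ((∫ V, ∏ p ∈ B, w (plaquetteHolonomy V p.1 p.2.1.1 p.2.1.2)
            ∂(Measure.pi fun _ : Edge d L => haarProbability G)) *
            ∏ p ∈ Finset.univ \ B, w (plaquetteHolonomy U p.1 p.2.1.1 p.2.1.2))))⁻¹) (Fin.cons (α := fun _ : Fin (m + 2) => GaugeConfig d L G) U y i)))
      ∂(Measure.pi fun _ : Fin (m + 1) => q))
    {S : Set (GaugeConfig d L G)} (hS : MeasurableSet S) :
    ∫⁻ U, P U S ∂π = π S := by
  obtain ⟨_, hρq, _, hρm, hρpos⟩ := heatBath_cold_acceptMass_eq hL hw hm0 hm hM hw1 B t ht rank hrank π q hπ hq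
  set ρ : GaugeConfig d L G → ℝ := fun U => ((∫ V, ∏ p : Plaquette d L, w (plaquetteHolonomy V p.1 p.2.1.1 p.2.1.2) ∂(Measure.pi fun _ : Edge d L => haarProbability G)) /
          ((∫ V, ∏ p ∈ B, w (plaquetteHolonomy V p.1 p.2.1.1 p.2.1.2)
            ∂(Measure.pi fun _ : Edge d L => haarProbability G)) *
            ∏ p ∈ Finset.univ \ B, w (plaquetteHolonomy U p.1 p.2.1.1 p.2.1.2))) with hρ
  have hw0' : ∀ U, 0 < (ρ U)⁻¹ := fun U => inv_pos.2 (hρpos U)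
  have hwm' : Measurable fun U => (ρ U)⁻¹ := hρm.inv
  have hπ' : (q.withDensity fun U => ENNReal.ofReal (ρ U)⁻¹) = π := withDensity_inv_density hρm hρpos hρq
  have h := multiProposal_invariant (q := q) (w := fun U => (ρ U)⁻¹) (n := m + 1) hwm' hw0' P hP hS
  rwa [hπ'] at h

/-- **BATCHING BUYS MIXING FOR THE EXACT HEAT-BATH GAUGE SAMPLER**: for every initial law `μ₀`, every `t` and every set `S`,
`|μ₀Pᵗ(S) − π(S)| ≤ (1 − (m + 1)/(2/A + m))ᵗ`, `1/A = c^{#B} M₀^{#Bᶜ}/Z` the cold importance weight. [ours] -/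
theorem heatBath_multiProposal_uniformlyErgodic (hL : 2 ≤ L) {w : G → ℝ} (hw : Continuous w) {m₀ M₀ : ℝ} (hm0 : 0 < m₀)
    (hm : ∀ g, m₀ ≤ w g) (hM : ∀ g, w g ≤ M₀) (hw1 : w 1 = M₀)
    (B : Finset (Plaquette d L)) (t : Plaquette d L → Edge d L)
    (ht : ∀ p ∈ B, t p ∈ ({(p.1, p.2.1.1), (p.1.shift p.2.1.1, p.2.1.2),
        (p.1.shift p.2.1.2, p.2.1.1), (p.1, p.2.1.2)} : Finset (Edge d L)))
    (rank : Plaquette d L → ℕ)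
    (hrank : ∀ p ∈ B, ∀ p' ∈ B, p ≠ p' → t p ∈ ({(p'.1, p'.2.1.1), (p'.1.shift p'.2.1.1, p'.2.1.2),
        (p'.1.shift p'.2.1.2, p'.2.1.1), (p'.1, p'.2.1.2)} : Finset (Edge d L)) → rank p < rank p')
    (π q : Measure (GaugeConfig d L G)) [IsProbabilityMeasure π] [IsProbabilityMeasure q]
    (hπ : π = (Measure.pi fun _ : Edge d L => haarProbability G).withDensity fun U =>
      ENNReal.ofReal ((∏ p : Plaquette d L, w (plaquetteHolonomy U p.1 p.2.1.1 p.2.1.2)) /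
        ∫ V, ∏ p : Plaquette d L, w (plaquetteHolonomy V p.1 p.2.1.1 p.2.1.2)
          ∂(Measure.pi fun _ : Edge d L => haarProbability G)))
    (hq : q = (Measure.pi fun _ : Edge d L => haarProbability G).withDensity fun U =>
      ENNReal.ofReal ((∏ p ∈ B, w (plaquetteHolonomy U p.1 p.2.1.1 p.2.1.2)) /
        ∫ V, ∏ p ∈ B, w (plaquetteHolonomy V p.1 p.2.1.1 p.2.1.2)
          ∂(Measure.pi fun _ : Edge d L => haarProbability G)))
    {m : ℕ} (P : Kernel (GaugeConfig d L G) (GaugeConfig d L G))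
    (hP : ∀ (U : GaugeConfig d L G) {S : Set (GaugeConfig d L G)}, MeasurableSet S → P U S =
      ∫⁻ y, (∑ j, ENNReal.ofReal ((fun U : GaugeConfig d L G =>
        (((∫ V, ∏ p : Plaquette d L, w (plaquetteHolonomy V p.1 p.2.1.1 p.2.1.2) ∂(Measure.pi fun _ : Edge d L => haarProbability G)) /
          ((∫ V, ∏ p ∈ B, w (plaquetteHolonomy V p.1 p.2.1.1 p.2.1.2)
            ∂(Measure.pi fun _ : Edge d L => haarProbability G)) *
            ∏ p ∈ Finset.univ \ B, w (plaquetteHolonomy U p.1 p.2.1.1 p.2.1.2))))⁻¹) (Fin.cons (α := fun _ : Fin (m + 2) => GaugeConfig d L G) U y j)) *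
        S.indicator (fun _ => (1 : ℝ≥0∞)) (Fin.cons (α := fun _ : Fin (m + 2) => GaugeConfig d L G) U y j)) /
      (∑ i, ENNReal.ofReal ((fun U : GaugeConfig d L G =>
        (((∫ V, ∏ p : Plaquette d L, w (plaquetteHolonomy V p.1 p.2.1.1 p.2.1.2) ∂(Measure.pi fun _ : Edge d L => haarProbability G)) /
          ((∫ V, ∏ p ∈ B, w (plaquetteHolonomy V p.1 p.2.1.1 p.2.1.2)
            ∂(Measure.pi fun _ : Edge d L => haarProbability G)) *
            ∏ p ∈ Finset.univ \ B, w (plaquetteHolonomy U p.1 p.2.1.1 p.2.1.2))))⁻¹) (Fin.cons (α := fun _ : Fin (m + 2) => GaugeConfig d L G) U y i)))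
      ∂(Measure.pi fun _ : Fin (m + 1) => q))
    (μ₀ : Measure (GaugeConfig d L G)) [IsProbabilityMeasure μ₀] (tt : ℕ) (S : Set (GaugeConfig d L G)) :
    |((fun ν : Measure (GaugeConfig d L G) => ν.bind P)^[tt] μ₀).real S - π.real S| ≤
      (1 - (m + 1) / (2 * (((∫ g, w g ∂(haarProbability G)) ^ B.card * M₀ ^ (Finset.univ \ B).card) / (∫ V, ∏ p : Plaquette d L, w (plaquetteHolonomy V p.1 p.2.1.1 p.2.1.2) ∂(Measure.pi fun _ : Edge d L => haarProbability G))) + m)) ^ tt := by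
  obtain ⟨hA, hρq, hmax, hρm, hρpos⟩ := heatBath_cold_acceptMass_eq hL hw hm0 hm hM hw1 B t ht rank hrank π q hπ hq
  set cold : GaugeConfig d L G := fun _ => (1 : G) with hcold
  set ρ : GaugeConfig d L G → ℝ := fun U => ((∫ V, ∏ p : Plaquette d L, w (plaquetteHolonomy V p.1 p.2.1.1 p.2.1.2) ∂(Measure.pi fun _ : Edge d L => haarProbability G)) /
          ((∫ V, ∏ p ∈ B, w (plaquetteHolonomy V p.1 p.2.1.1 p.2.1.2)
            ∂(Measure.pi fun _ : Edge d L => haarProbability G)) *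
            ∏ p ∈ Finset.univ \ B, w (plaquetteHolonomy U p.1 p.2.1.1 p.2.1.2))) with hρ
  have hw0' : ∀ U, 0 < (ρ U)⁻¹ := fun U => inv_pos.2 (hρpos U)
  have hwm' : Measurable fun U => (ρ U)⁻¹ := hρm.inv
  have hπ' : (q.withDensity fun U => ENNReal.ofReal (ρ U)⁻¹) = π := withDensity_inv_density hρm hρpos hρq
  haveI : IsProbabilityMeasure (q.withDensity fun U => ENNReal.ofReal (ρ U)⁻¹) := by rw [hπ']; infer_instance
  have hone : ∫⁻ y, ENNReal.ofReal (ρ y)⁻¹ ∂q = ENNReal.ofReal 1 := by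
    have h : π Set.univ = 1 := measure_univ
    rw [← hπ', withDensity_apply _ MeasurableSet.univ, Measure.restrict_univ] at h
    rw [h, ENNReal.ofReal_one]
  have hA' := imhAcceptMass_toReal_eq_of_forall_le (q := q) hw0' cold hmax zero_le_one hone
  have hW : (ρ cold)⁻¹ = ((∫ g, w g ∂(haarProbability G)) ^ B.card * M₀ ^ (Finset.univ \ B).card) / (∫ V, ∏ p : Plaquette d L, w (plaquetteHolonomy V p.1 p.2.1.1 p.2.1.2) ∂(Measure.pi fun _ : Edge d L => haarProbability G)) := by
    have h1 : ((ρ cold)⁻¹)⁻¹ = (∫ V, ∏ p : Plaquette d L, w (plaquetteHolonomy V p.1 p.2.1.1 p.2.1.2) ∂(Measure.pi fun _ : Edge d L => haarProbability G)) / ((∫ g, w g ∂(haarProbability G)) ^ B.card * M₀ ^ (Finset.univ \ B).card) := by rw [← hA, hA', one_div]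
    rw [← inv_inv (ρ cold)⁻¹, h1, inv_div]
  have h := multiProposal_uniformlyErgodic (q := q) (w := fun U => (ρ U)⁻¹) (m := m) hwm' hw0' (W := (ρ cold)⁻¹) hmax P hP μ₀ tt S
  rw [hπ', hW] at h
  exact h

end Summit.Ventures.LatticeQCDFlow.Theory2.Autoregressive
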